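import Mathlib
import HarnessLib
import Summits.HubbardSuperconductivity.HubbardSuperconductivity.Theorems.KLProgrammeKLRegimeEngineTowerWtLawOfBlocksKlEng
import Summits.HubbardSuperconductivity.HubbardSuperconductivity.Theorems.KLProgrammeKLRegimeEngineTowerWtReadoutFit
import Summits.HubbardSuperconductivity.HubbardSuperconductivity.Theorems.KLProgrammeKLRegimeEngineTowerParityUnits
import Summits.HubbardSuperconductivity.HubbardSuperconductivity.Theorems.KLProgrammeKLRegimeKernelNormsLevelsDegreeCap

/-!
# Route `KLProgramme` — crux K3 ENGINE (stmt-HubbardSuperconductivity-20437 `KLRegimeEngineV17F2`), stub (b) v2, THE WEIGHTED HALF «(b)-WT4»: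
# W8 — «(b)-WT4-ASSEMBLY-∀j»: stub (b)'s weighted clause `∀ j ≤ n, KernelNormsWt4 L M (klWtBudget P Qe U j) β U μ (K_n) j` ON THE FLOW FRAME, from the one-track
# weighted law (W5) and the weighted read-out fit (W7b), with the low levels, the degree-4/6 cells, the base datum, the imports and the numerics as ROWS
# (cell gate-hubbard-kl, seat hubbard-kl-k3c3-p2 g17; weighted twin of this lineage's `kernelNormsLevels_all_klEng_final` (g16, p696349); E1 may rename or supersede)

DEGREE SPLIT of `KernelNormsWt4 … j` (every `m ≠ 2`): odd `m` vanish (`klWtPinnedSum_eq_zero_of_odd`, the action is even — `kernelNormsWt4_of_even`); `m = 0` has no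
pin (`Fin 0`); `m = 4, 6` are the two IMPORT CELLS at level `j` (k3c2-p3's `klWtPinnedSum_four/_six_le_of_wplain_flow_all` modulo E1's weighted plain lines
`S₄ʷ(j)`, `S₆ʷ(j)` — rows here); `m = 2p`, `4 ≤ p ≤ D` is W7b's read-out fit on W5's law at `(K_b := j/d, rate j)`; `2p > 2D` vanishes by nilpotency
(`kernel_map_sectorAnalysis` + `sectorisedKernel_eq_zero_of_card_lt`, `card(HubbardFieldIdx) ≤ 2D + 1` is part of the cap choice `exists_degreeCap`).
LEVEL SPLIT: `j < d` (no complete block yet) is a ROW CLASS here [p3 block-0 class: the weighted twin of `kernelNormsLevels_blockZeroF_klEng`, cf. WB2/WB3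
`baseLawWtF_blockZero_klEng(_closed)` p700691/p701078]; `d ≤ j ≤ n`: `K_b := j/d ≥ 1`, `d·K_b ≤ j < d·K_b + d`.
* §1 `klWtPinnedSum_eq_zero_of_card_lt` — degrees above the number of field labels carry nothing;
* §2 **`kernelNormsWt4_all_klEng (d R c″)`** — head `∃` (W5's five + W7b's seven constants), `R.WF2 → ∃ c₃′ U₀′`; binders = v1 doors + history at scale `n` + (K5′),
  `2 ≤ d`, cap `D` (`3 ≤ D`, every block `d·k ≤ n`, `card(HubbardFieldIdx) ≤ 2D+1`), `B ≥ 1` (`λ_j = B·ε_j`), law constants `A Q′ A_b Q_b`, the BASE DATUM rows at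
  `(F_{d−1}, rate j)` for every `d ≤ j ≤ n` [p3: WB3 + `klTowerMeasWtAt_one_baseRowsW`], `Z^{K_n}_{Λ_d} ≠ 0` [p3], dominants `κ̄ ᾱ c̄r c̄c` of BOTH packages' constants,
  names `W Z σ τ ψ Φ` (W2), profile constants `A′ Q″` (four dominations), IMPORTS `ι₁ ι₂ ι₃` at every block `d·k ≤ j` for every rate `j` [E1 via k3c2-p3's
  `importBindersWt_of_wplainLines_flow_all` p700454], NUMERICS at every level `d ≤ j ≤ n` (eight kit rows at `λ_j`) and the read-out `CE` row with
  `A_tot j`, `Q_tot j` equational [p4 «part 4»], the two CELLS at every level `j ≤ n` and the LOW LEVELS `j < d` [rows] ⊢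
  **`∀ j ≤ n, KernelNormsWt4 L M (klWtBudget P Qe U j) β U μ (klFlowFrameU L M β U μ n) j`.**
Compositions of landed theorems; nothing about the model is asserted beyond them; nothing asserts (b), WT4's rows, (ℓ), any stub, K3 or superconductivity.
References: BGM 2006 §2.8 (2.76)–(2.84), (2.93)–(2.98), Lemma 2.5, §3 (3.2)–(3.8) [cite: BenfattoGiulianiMastropietro2006].
-/

noncomputable section

namespace Summit.HubbardSuperconductivity.HubbardSuperconductivity.Theorems.EngineV8

set_option linter.dupNamespace false -- summit = problem name (single-conjunct summit), D-0017

open Classical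
open Real Finset Literature.MathematicalPhysics.QuantumLattice Literature.Probability.LatticeModels GrassmannAlgebra
open Literature.MathematicalPhysics.QuantumLattice.FermiRG Literature.MathematicalPhysics.QuantumLattice.FermiRG.BGM2006Routing
open Summit.HubbardSuperconductivity.HubbardSuperconductivity.Theorems.KLProgrammeLegKernels
open Summit.HubbardSuperconductivity.HubbardSuperconductivity.Theorems.KLRegimeSplit
open Summit.HubbardSuperconductivity.HubbardSuperconductivity.Theorems.KLRegimeWick
open Summit.HubbardSuperconductivity.HubbardSuperconductivity.Theorems.TwoPointAssembly
open Summit.HubbardSuperconductivity.HubbardSuperconductivity.Theorems.DispersionFlow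
open Summit.HubbardSuperconductivity.HubbardSuperconductivity.Theorems.TorusFourierL2

variable {L M : ℕ} [NeZero L] [NeZero M]

/-! ## §1 Degrees above the number of field labels carry nothing -/

omit [NeZero M] in
/-- **`klWtPinnedSum … m q w = 0` when `card (HubbardFieldIdx L M) < m`** (the analysed kernels are sectorised kernels of the action, which vanish above the
number of labels). -/
theorem klWtPinnedSum_eq_zero_of_card_lt (β U μ : ℝ) (K : TrigPolyC4v) (j : ℕ) {m : ℕ} (hm : Fintype.card (HubbardFieldIdx L M) < m) (q : Fin m)
    (w : SpaceTimeIdx L M × SectorLeg (sectorCount j)) : klWtPinnedSum L M β U μ K j m q w = 0 := by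
  rw [klWtPinnedSum_def]
  refine mul_eq_zero_of_right _ (sum_eq_zero fun X _ => ?_)
  rw [kernel_map_sectorAnalysis, sectorisedKernel_eq_zero_of_card_lt β _ _ hm, norm_zero, mul_zero]

/-! ## §2 The weighted clause at every level -/

set_option maxHeartbeats 800000 in -- one ~200-binder composition instantiated per level
/-- **STUB (b)'s WEIGHTED CLAUSE ON THE FLOW FRAME — ASSEMBLY** («(b)-WT4-ASSEMBLY-∀j»; see the module docstring for the binder list and the row classes);
conclusion `∀ j ≤ n, KernelNormsWt4 L M (klWtBudget P Qe U j) β U μ (klFlowFrameU L M β U μ n) j`.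
[cite: BenfattoGiulianiMastropietro2006, §2.8 (2.76)-(2.84), (2.93)-(2.98), Lemma 2.5 (2.98), §3 (3.2)-(3.8)] -/
theorem kernelNormsWt4_all_klEng (d : ℕ) (R : RenConsts) (c'' : ℝ) (hc'' : 0 < c'') :
    ∃ C₁ C₂ Cκ Cb CJ C₁r C₂r Cκr Cbr CJr C₁i C₂i : ℝ, 0 < C₁ ∧ 0 < C₂ ∧ 0 < Cκ ∧ 0 < Cb ∧ 0 < CJ ∧
      0 < C₁r ∧ 0 < C₂r ∧ 0 < Cκr ∧ 0 < Cbr ∧ 0 < CJr ∧ 0 < C₁i ∧ 0 < C₂i ∧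
      (R.WF2 → ∃ c₃' : ℝ, 0 < c₃' ∧ ∃ U₀' : ℝ, 0 < U₀' ∧
      ∀ (G : GeoConsts) (P : SplitConsts) (Q : EngConsts) (c : ℝ), P.WF → 0 < c → c ≤ klEngC₃6 P R → c ≤ c₃' →
      ∀ μ ∈ klWindowC, ∀ U : ℝ, 0 < U → U ≤ klEngU₀9 P R c → U ≤ U₀' → c'' * U ≤ 1 →
      ∀ β : ℝ, klBetaMin ≤ β → β ≤ Real.exp (c / U ^ 2) →
      ∀ (L M : ℕ) [NeZero L] [NeZero M], klEngL₃ β U ≤ L → klEngM₃ β U L ≤ M →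
      ∀ n : ℕ, 1 ≤ n → n ≤ nScales β + 1 → IsKLRegime U c (-(n : ℤ)) → HistP klPredsV17F2 L M G P Q R β U μ 0 n →
        (∀ m', 1 ≤ m' → m' < n → FlowPieceOscAt L M c'' β U μ m') →
      2 ≤ d →
      -- the degree caps [choice: `exists_degreeCap`]
      ∀ D : ℕ, 3 ≤ D → (∀ k, 1 ≤ k → d * k ≤ n → Fintype.card (SpaceTimeIdx L M × SectorLeg (sectorCount (d * k - 1))) / 2 ≤ D) →
        Fintype.card (HubbardFieldIdx L M) ≤ 2 * D + 1 →
      -- the coupling amplitude and the law's constants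
      ∀ (B A Q' Ab Qb : ℝ), 1 ≤ B → 0 ≤ A → 0 < Q' → 0 ≤ Ab → 0 ≤ Qb →
      -- the base datum of `𝒱_d` at `(F_{d−1}, rate j)` for every read-out rate `d ≤ j ≤ n` [p3: WB3 `baseLawWtF_blockZero_klEng_closed` + `klTowerMeasWtAt_one_baseRowsW`]
      ∀ Nb : ℕ → ℕ → ℝ, (∀ j p, 0 ≤ Nb j p) →
        (∀ j, d ≤ j → j ≤ n → ∀ (p : ℕ) (q : Fin (2 * p)) (w' : SpaceTimeIdx L M × SectorLeg (sectorCount (d - 1))),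
          klWtPinnedSumAt L M β μ (klFlowFrameU L M β U μ n) (d - 1) j (2 * p) (klTowerInput L M β U μ (klFlowFrameU L M β U μ n) d 1) q w' ≤ Nb j p) →
        (∀ j, d ≤ j → j ≤ n → ∀ p : ℕ, 3 ≤ p → Nb j p / klLevUnitF β M 0 p (d - 1) ≤ Ab * (B * epsCoupling P U j) ^ (p - 1) * Qb ^ p) →
      hubbardEffPartitionFnCT L M β U μ 0 (klFlowFrameU L M β U μ n) (klScale klE0 d) ≠ 0 →
      -- dominants of the LINK's and of the read-out's constants, and the names
      ∀ (κb αb crb ccb : ℝ), Real.sqrt (2 * Cκ * klE0) ≤ κb → Cb * ((M : ℝ) / β) * (4 : ℝ) ^ d / klE0 ≤ αb →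
        81 * CJ * M / β ≤ crb → 162 * CJ * M / β ≤ ccb →
        Real.sqrt (2 * Cκr * klE0) ≤ κb → Cbr * ((M : ℝ) / β) * (4 : ℝ) ^ d / klE0 ≤ αb → 81 * CJr * M / β ≤ crb → 162 * CJr * M / β ≤ ccb →
      ∀ (W Z σ τ ψ Φ : ℝ),
        W = 32 * crb / ccb → Z = imagTimeWeight β M ^ 2 * ccb ^ 2 / 8 →
        σ = κb ^ 2 / ccb ^ 2 → τ = 4 * exp 4 * κb ^ 2 / ccb ^ 2 → ψ = ccb ^ 2 / κb ^ 2 → Φ = exp 1 * αb * ccb / (κb ^ 2 * crb) →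
      ∀ (A' Q'' : ℝ),
        W * ((C₁ / C₂) * (8 : ℝ) ^ (d - 1) * (Ab + A / (1 - ((2 : ℝ) ^ d)⁻¹))) ≤ A' →
        Z * (C₂ ^ 2 * ((2 : ℝ) ^ (d - 1))⁻¹ * max Q' Qb) ≤ Q'' → W * Ab ≤ A' → Z * Qb ≤ Q'' → 0 < Q'' →
      -- the weighted imports at every block `d·k ≤ j`, every rate `d ≤ j ≤ n` [E1 via k3c2-p3 `importBindersWt_of_wplainLines_flow_all`]
      ∀ (ι₁ ι₂ ι₃ : ℝ),
      (∀ j, d ≤ j → j ≤ n → ∀ k, 1 ≤ k → d * k ≤ j → W * Z ^ 1 *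
        (klTowerMeasWtAt L M β U μ (klFlowFrameU L M β U μ n) d k j (2 * 1) / klLevUnitF β M 0 1 (d * k - 1)) ≤ ι₁ * (B * epsCoupling P U j)) →
      (∀ j, d ≤ j → j ≤ n → ∀ k, 1 ≤ k → d * k ≤ j → W * Z ^ 2 *
        (klTowerMeasWtAt L M β U μ (klFlowFrameU L M β U μ n) d k j (2 * 2) / klLevUnitF β M 0 2 (d * k - 1)) ≤ ι₂ * (B * epsCoupling P U j)) →
      (∀ j, d ≤ j → j ≤ n → ∀ k, 1 ≤ k → d * k ≤ j → W * Z ^ 3 *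
        (klTowerMeasWtAt L M β U μ (klFlowFrameU L M β U μ n) d k j (2 * 3) / klLevUnitF β M 0 3 (d * k - 1)) ≤ ι₃ * (B * epsCoupling P U j) ^ 2) →
      -- the kit's numerics at every read-out rate [p4 «part 4»]
      (∀ j, d ≤ j → j ≤ n →
        4 * σ * (B * epsCoupling P U j) * Q'' < 1 ∧ 2 * (B * epsCoupling P U j) * τ * Q'' ≤ 1 ∧ exp 1 * τ * (B * epsCoupling P U j) * Q'' < 1 ∧
        Φ * (τ * (ι₁ * (B * epsCoupling P U j) + ι₂ / (2 * Q'') + ι₃ / (4 * Q'' ^ 2) + A' * Q'' / 4)) < 1 ∧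
        Φ * (exp 1 * τ * (ι₁ * (B * epsCoupling P U j)) + (exp 1 * τ) ^ 2 * (ι₂ * (B * epsCoupling P U j)) +
          (exp 1 * τ) ^ 3 * (ι₃ * (B * epsCoupling P U j) ^ 2) +
          A' * (exp 1 * τ * Q'') * ((exp 1 * τ * (B * epsCoupling P U j) * Q'') ^ 3 / (1 - exp 1 * τ * (B * epsCoupling P U j) * Q''))) < 1 ∧
        4 * Q'' ≤ Q' ∧ 2 * τ * ψ * Q'' ≤ Q' ∧
        A' * (4 * Q'') ^ 3 * (4 * σ * (B * epsCoupling P U j) * Q'' / (1 - 4 * σ * (B * epsCoupling P U j) * Q'')) +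
          exp 1 * ψ * (2 * τ * ψ * Q'') ^ 2 * (τ * (ι₁ * (B * epsCoupling P U j) + ι₂ / (2 * Q'') + ι₃ / (4 * Q'' ^ 2) + A' * Q'' / 4)) *
            (Φ * (τ * (ι₁ * (B * epsCoupling P U j) + ι₂ / (2 * Q'') + ι₃ / (4 * Q'' ^ 2) + A' * Q'' / 4)) /
              (1 - Φ * (τ * (ι₁ * (B * epsCoupling P U j) + ι₂ / (2 * Q'') + ι₃ / (4 * Q'' ^ 2) + A' * Q'' / 4)))) ≤ A * Q' ^ 3) →
      -- the read-out constants level by level and the budget package's `CE` row [p4]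
      ∀ (Qe : EngConsts) (Atot Qtot : ℕ → ℝ),
        (∀ j, Qtot j = max 1 (C₂i ^ 2) * max 1 (max (C₂r ^ 2 * max Q' Qb) (max (4 * Q'') (2 * τ * ψ * Q'')))) →
        (∀ j, Atot j = C₁r / C₂r * (Ab + A) + C₁i / C₂i * (A' * (4 * σ * (B * epsCoupling P U j) * Q'' / (1 - 4 * σ * (B * epsCoupling P U j) * Q'')) +
          exp 1 * ψ * (τ * (ι₁ * (B * epsCoupling P U j) + ι₂ / (2 * Q'') + ι₃ / (4 * Q'' ^ 2) + A' * Q'' / 4)) *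
            (Φ * (τ * (ι₁ * (B * epsCoupling P U j) + ι₂ / (2 * Q'') + ι₃ / (4 * Q'' ^ 2) + A' * Q'' / 4)) /
              (1 - Φ * (τ * (ι₁ * (B * epsCoupling P U j) + ι₂ / (2 * Q'') + ι₃ / (4 * Q'' ^ 2) + A' * Q'' / 4)))))) →
        (∀ j, d ≤ j → j ≤ n → Qtot j * imagTimeWeight β M ^ 2 * B * max 1 (Atot j / imagTimeWeight β M) ≤ Qe.CE) → 0 ≤ Qe.CE →
      -- the two import cells at every level [E1 via k3c2-p3 `klWtPinnedSum_four/_six_le_of_wplain_flow_all`] and the low levels [p3 block-0 class]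
      (∀ j, j ≤ n → ∀ (q : Fin 4) (w : SpaceTimeIdx L M × SectorLeg (sectorCount j)),
        klWtPinnedSum L M β U μ (klFlowFrameU L M β U μ n) j 4 q w ≤ klWtBudget P Qe U j 4) →
      (∀ j, j ≤ n → ∀ (q : Fin 6) (w : SpaceTimeIdx L M × SectorLeg (sectorCount j)),
        klWtPinnedSum L M β U μ (klFlowFrameU L M β U μ n) j 6 q w ≤ klWtBudget P Qe U j 6) →
      (∀ j, j < d → j ≤ n → KernelNormsWt4 L M (klWtBudget P Qe U j) β U μ (klFlowFrameU L M β U μ n) j) →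
      ∀ j, j ≤ n → KernelNormsWt4 L M (klWtBudget P Qe U j) β U μ (klFlowFrameU L M β U μ n) j) := by
  obtain ⟨C₁, C₂, Cκ, Cb, CJ, hC₁, hC₂, hCκ, hCb, hCJ, hlaw⟩ := klTowerBornWtAt_le_law_of_blocks_klEng_tokX d R c'' hc''
  obtain ⟨C₁r, C₂r, Cκr, Cbr, CJr, C₁i, C₂i, hC₁r, hC₂r, hCκr, hCbr, hCJr, hC₁i, hC₂i, hfit⟩ := klWtPinnedSum_le_klWtBudget_of_wtLaw_klEng d R c'' hc''
  refine ⟨C₁, C₂, Cκ, Cb, CJ, C₁r, C₂r, Cκr, Cbr, CJr, C₁i, C₂i, hC₁, hC₂, hCκ, hCb, hCJ, hC₁r, hC₂r, hCκr, hCbr, hCJr, hC₁i, hC₂i, fun hR2 => ?_⟩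
  obtain ⟨c₃a, hc₃a, U₀a, hU₀a, hlaw'⟩ := hlaw hR2
  obtain ⟨c₃b, hc₃b, U₀b, hU₀b, hfit'⟩ := hfit hR2
  refine ⟨min c₃a c₃b, lt_min hc₃a hc₃b, min U₀a U₀b, lt_min hU₀a hU₀b, ?_⟩
  intro G P Q c hP hc hc6 hc₃' μ hμ U hU hU9 hU₀' hcU β hβmin hβc L M _ _ hL3 hM3 n hn1 hnN hkl hhist hosc hd D hD3 hD hcard
    B A Q' Ab Qb hB hA hQ hAb hQb Nb hNb0 hcar hlawb hZd κb αb crb ccb hκb hαb hcrb hccb hκbr hαbr hcrbr hccbr W Z σ τ ψ Φ hW hZ' hσ hτ hψ hΦ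
    A' Q'' hA'1 hQ'1 hA'2 hQ'2 hQ'0 ι₁ ι₂ ι₃ hι₁ hι₂ hι₃ hnum Qe Atot Qtot hQtot hAtot hCE hCE0 hcell4 hcell6 hlow j hjn
  obtain ⟨hc₃a', hc₃b'⟩ : c ≤ c₃a ∧ c ≤ c₃b := le_min_iff.1 hc₃'
  obtain ⟨hU₀a', hU₀b'⟩ : U ≤ U₀a ∧ U ≤ U₀b := le_min_iff.1 hU₀'
  have hβ : 0 < β := KLRegimeSplit.pos_of_klBetaMin_le hβmin
  have hK1 : 1 ≤ P.Klam := hP.1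
  have hKl : 0 ≤ P.Klam := le_trans zero_le_one hK1
  set K : TrigPolyC4v := klFlowFrameU L M β U μ n with hKdef
  -- low levels: a row
  rcases Nat.lt_or_ge j d with hjd | hjd
  · exact hlow j hjd hjn
  -- `d ≤ j`: the block count `K_b := j / d`
  set Kb : ℕ := j / d with hKb
  have hdpos : 0 < d := by omega
  have hKb1 : 1 ≤ Kb := (Nat.le_div_iff_mul_le hdpos).2 (by simpa using hjd)
  have hKbj : d * Kb ≤ j := by rw [hKb, mul_comm]; exact Nat.div_mul_le_self j d
  have hjd' : j ≤ d * Kb + d := by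
    have := Nat.lt_div_mul_add hdpos (a := j); rw [hKb]; rw [mul_comm] at this; omega
  -- the coupling at the read-out rate
  set lam : ℝ := B * epsCoupling P U j with hlam
  have hε : 0 ≤ epsCoupling P U j := epsCoupling_nonneg' hKl U j
  have hεpos : 0 < epsCoupling P U j := by
    unfold epsCoupling; have : 0 < P.Klam := by linarith
    positivity
  have hlampos : 0 < lam := by rw [hlam]; positivity
  obtain ⟨hx₁, hx₂, hx₃, hy, hθ, hu₁, hu₂, hclose⟩ := hnum j hjd hjn
  -- caps for the blocks of this run
  have hDk : ∀ k, 1 ≤ k → k ≤ Kb → Fintype.card (SpaceTimeIdx L M × SectorLeg (sectorCount (d * k - 1))) / 2 ≤ D :=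
    fun k hk1 hk => hD k hk1 (le_trans (Nat.mul_le_mul_left d hk) (hKbj.trans hjn))
  -- (1) the weighted law at `(K_b, rate j)`
  have hL := hlaw' G P Q c hP hc hc6 hc₃a' μ hμ U hU hU9 hU₀a' hcU β hβmin hβc L M hL3 hM3 n hn1 hnN hkl hhist hosc hd Kb j hKb1 hKbj hjn D hD3 hDk
    A lam Q' Ab Qb hA hlampos hQ hAb hQb (Nb j) (hNb0 j) (hcar j hjd hjn) (hlawb j hjd hjn) hZd κb αb crb ccb hκb hαb hcrb hccb W Z σ τ ψ Φ hW hZ' hσ hτ hψ hΦ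
    A' Q'' hA'1 hQ'1 hA'2 hQ'2 hQ'0 ι₁ ι₂ ι₃ (fun k hk1 hk => hι₁ j hjd hjn k hk1 (le_trans (Nat.mul_le_mul_left d hk) hKbj))
    (fun k hk1 hk => hι₂ j hjd hjn k hk1 (le_trans (Nat.mul_le_mul_left d hk) hKbj))
    (fun k hk1 hk => hι₃ j hjd hjn k hk1 (le_trans (Nat.mul_le_mul_left d hk) hKbj)) hx₁ hx₂ hx₃ hy hθ hu₁ hu₂ hclose
  obtain ⟨hZall, hlawKb, hrows⟩ := hL
  have hA'0 : 0 ≤ A' := le_trans (by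
    have hW0 : 0 ≤ W := by rw [hW]; have : 0 ≤ crb := le_trans (by positivity) hcrb; have : 0 ≤ ccb := le_trans (by positivity) hccb; positivity
    positivity) hA'2
  -- (2) the read-out fit at `(K_b, j)` in degrees `8 ≤ 2p ≤ 2D`
  have hF := hfit' G P Q c hP hc hc6 hc₃b' μ hμ U hU hU9 hU₀b' hcU β hβmin hβc L M hL3 hM3 n hn1 hnN hkl hhist hosc hd Kb j hKb1 hKbj hjn hjd' D hD3
    (hDk Kb hKb1 le_rfl) (hZall Kb hKb1 le_rfl) B A lam Q' Ab Qb hB rfl hA hlampos hQ hAb hQb (Nb j) (hNb0 j) (hcar j hjd hjn) (hlawb j hjd hjn) hlawKb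
    κb αb crb ccb hκbr hαbr hcrbr hccbr W Z σ τ ψ Φ hW hZ' hσ hτ hψ hΦ A' Q'' ι₁ ι₂ ι₃ hA'0 hQ'0 (hrows Kb hKb1 le_rfl)
    (hι₁ j hjd hjn Kb hKb1 hKbj) (hι₂ j hjd hjn Kb hKb1 hKbj) (hι₃ j hjd hjn Kb hKb1 hKbj) hx₁ hx₂ hx₃ hy hθ (Atot j) (Qtot j) (hQtot j) (hAtot j) Qe
    (hCE j hjd hjn)
  -- (3) the degree split
  refine kernelNormsWt4_of_even hβ.ne' (fun m _ => klWtBudget_nonneg hCE0 hKl U j m) fun m hm hm2 q w => ?_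
  obtain ⟨p, rfl⟩ : ∃ p, m = 2 * p := by obtain ⟨r, hr⟩ := hm; exact ⟨r, by omega⟩
  rcases Nat.lt_or_ge p 4 with hp4 | hp4
  · -- `p ≤ 3`: `p = 0` has no pin, `p = 1` is carved, `p = 2, 3` are the cells
    interval_cases p
    · exact q.elim0
    · exact absurd rfl hm2
    · exact hcell4 j hjn q w
    · exact hcell6 j hjn q w
  · rcases Nat.lt_or_ge D p with hDp | hpD
    · -- above the cap: nilpotency
      rw [klWtPinnedSum_eq_zero_of_card_lt β U μ K j (by omega) q w]
      exact klWtBudget_nonneg hCE0 hKl U j _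
    · exact hF p hp4 hpD q w

end Summit.HubbardSuperconductivity.HubbardSuperconductivity.Theorems.EngineV8

end
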